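import Summits.QuantumFields.BalabanUV.Beta.D1BFx.PackedLettersAtSites
import Summits.QuantumFields.BalabanUV.Beta.D1BFx.PackedTowerCombine

/-!
# `BalabanUV.Beta.D1BFx.PackedLiteralCombine` — road «BF-x» for binder row D1, slot (K), chain step (I) «(A1)-PACKED», brick (B3) PART 3b
# «A1-PACKED-TORUS — INSTANTIATION» (`A1-PACKED-SPEC.md` v0.4 §8∕§9): **THE `ℤ⁴` IDENTITY OF THE COVARIANT ORGANISATION FOR THE LITERAL's
# RESPONSE-PACKED JETS, WITH EVERY M-SIDE LETTER OF (B6′) A THEOREM** — leaf-03's `PackedTowerCombine.hessKer_transfer_road_cov_packed_of_uniform`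
# at `𝒱M k := vertexOfK G₀ (m+1) S` (k-CONSTANT), `𝒲M k := 𝒲^{((m+1)·p k)}` (the slice-summed one-periodised double superposition, F-g16-1),
# `𝒲M∞ := vertex2OfK G₀ (m+1) S₂` (THE BI-VERTEX BY NAME — PART 3a §4 `vertex2OfK_eq_sliceSum` identifies it with the slice-summed plain double superposition the
# WRAP lemmas deliver), packing weights `w := colH G₀ (m+1)` (the p-FREE `ℋ`-columns), responses = the columns of the
# torus comb-gauged KKT inverse at `(siteOf (p k) 0, μ)` ∕ `(siteOf (p k) z, ν)`; DISCHARGED INSIDE: (u1)∕(u2) for the M tables (`vertexFamily_vertexOfK`,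
# gan24-leaf-05's `biLoc_sliceSum_images_colH` + `KernelWard.biLoc_recentre`, `tendsto_sliceSum_images_colH`), the weights' decay (`colH_weight`), the
# response letters (PART 1c), the dictionary ∕ parity letters `hJM hJM′ hJM″ hkₛ hkₜ hkₛₜ` (PART 1 + PART 3a), the Ward letters `aₛ bₛ aₜ bₜ` (PART 3a, from
# the LIFTED [P1′]) and `aₛₜ bₛₜ` (PART 2b, from [P1′]∕[P2′]), the gauge-jet pins (`rfl`).

HONEST FRAMING (cell contract, verbatim): «discharging `BetaPertH` makes Bałaban's UV stability UNCONDITIONAL — a real constructive-QFT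
result; it is NOT the continuum limit and NOT the Clay problem.»  HONEST DEPENDENCY (verbatim): «continuum YM on T⁴ ⇐ BetaPertH ∧ nine
spine estimates (0/9 proved); BetaPertH ⇐ (D1) ∧ (D4) ∧ CAP+tail; G-an2-4 gates asym, D1 and NE2/3/4.»  THIS MODULE DISCHARGES NOTHING of
D1 ∕ BetaPertH: [folklore] a composition BY NAME.  No `def`, no `def … : Prop`, nothing cited, 0 sorry.  NOT summit progress; NOT BetaPertH,
NOT continuum, NOT Clay.
STILL DISPLAYED (the literal's, and pins): the STRUCTURAL SOCKETS of the literal's first ∕ second derivative stencil families `S`, `S₂` (self-localisation,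
fine-translation covariance, no mm block, fm = ±kernel-transposed mf, ff (anti)symmetry, the `LocStencil₂` body); the per-bond torus data `K₁ Q₁ x₁ K₂ Q₂ x₂`
PINNED to the blocks of the periodised single-bond ∕ pair stencil arrays and to THE CONVENTION's generator jets (zero at the coarse-multiplier indices); the
LIFTED table-level Ward identities [P1′]∕[P2′] of the literal in the `ad e₃` model (ρ-g16-1′); the parity-typed jets `k• q•` PINNED to the blocks of
`(arr s 𝒱)ˆ` ∕ `(arr s 𝒲^{(s)})ˆ`; the responses `rS rT` PINNED to the columns of `M_T⁻¹`; TB4-W's co-frame pins; the N side (`𝒱N 𝒲N`, (u1)∕(u2), `hJN•`)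
VERBATIM as in (B6′); `Spr (Ga (m+1) a)`, `0 < a`, `r ∈ box 4 (m+1)`.

ABSOLUTE RULE (cell, verbatim): «No internally-minted statement may enter as a cited fact. Every hypothesis is either kernel-proved in this
package or a verbatim quotation of a PUBLISHED theorem with page reference. The manuscript(s) under audit are NOT citable for their own
disputed steps — they are the thing under adjudication; programme-internal (2001/route/tribunal) claims are never citable.»

CONTENT (all [folklore]): **`hessKer_transfer_road_cov_packed_literal`** (the bi-vertex read back BY NAME through PART 3a §4 `vertex2OfK_eq_sliceSum`).
Unit `b2b-balaban-beta-d1-p2` (road owner, gen 18), 2026-08-22; (B6′) by `b2b-balaban-beta-d1-formalise-leaf-03` (gen 22).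
-/

noncomputable section

namespace Summit.QuantumFields.BalabanUV.Beta.D1BFx.PackedLiteralCombine

open Matrix Filter Topology
open scoped BigOperators Kronecker
open Literature.Probability.LatticeModels (TorusSite)
open Literature.MathematicalPhysics.QuantumFieldTheory.Balaban1983to89
open Literature.MathematicalPhysics.QuantumFieldTheory.Balaban1983to89.Beta
open Literature.MathematicalPhysics.QuantumFieldTheory.Balaban1983to89.Beta.Composition (kkt)
open B12Sec2to5 (l1 l1_nonneg)
open ExpKernelCalculus (MKer Decays BiLoc comp hessKer shiftK Zl)
open AffineAveraging (box toSite unitVec)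
open OneStepResolventKernel (Fib wsum LocStencil)
open OneStepKernelFamily (KInvStep colH vertexOfK vertexFamily_vertexOfK)
open SecondOrderResponse (vertex2OfK)
open Summit.QuantumFields.BalabanUV.Beta.TameKernelCalculus (Spr)
open Summit.QuantumFields.BalabanUV.Beta.AxialDressingRooted (coDressKBmAt decays_coDressKBmAt_KInvStep)
open Summit.QuantumFields.BalabanUV.Beta.D1BFx.FibredPeriodisation (periodiseF)
open Summit.QuantumFields.BalabanUV.Beta.D1BFx.SortedKernels (blocksHat fTL fBL)
open Summit.QuantumFields.BalabanUV.Beta.D1BFx.SortedPack (sortK)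
open Summit.QuantumFields.BalabanUV.Beta.D1BFx.SortedReblocking (torusBlockEquiv)
open Summit.QuantumFields.BalabanUV.Beta.D1BFx.SortedEmbedding (e₁)
open Summit.QuantumFields.BalabanUV.Beta.D1BFx.PeriodicArrays (arr)
open Summit.QuantumFields.BalabanUV.Beta.D1BFx.GramWeightColourLift (tj₂ tgram₁ tgramMix)
open Summit.QuantumFields.BalabanUV.Beta.D1BFx.TorusCombKKT (I J CombRows tauT Khat Qhat)
open Summit.QuantumFields.BalabanUV.Beta.D1BFx.TorusGaugeBasis (What0)
open Summit.QuantumFields.BalabanUV.Beta.D1BFx.TorusGaugeBasisMatrix (Nhat)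
open Summit.QuantumFields.BalabanUV.Beta.D1BFx.TorusCoframeJets (Djet Tjet₀ Tjet₁ Tjet₁₁ Ajet₀ Ajet₁ Ajet₁₁)
open Summit.QuantumFields.BalabanUV.Beta.D1BFx.RWeightedLegPack (NlegRoad)
open Summit.QuantumFields.BalabanUV.Beta.D1BFx.GaugeJetLocal (idK1)
open Summit.QuantumFields.BalabanUV.Beta.D1BFx.KGhostLeg (Cgh)
open Summit.QuantumFields.BalabanUV.Beta.D1BFx.GhostStencil (ghCur)
open Summit.QuantumFields.BalabanUV.Beta.D1BFx.TorusGhostWordArrays (lapU Lgh)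
open Summit.QuantumFields.BalabanUV.Beta.D1BFx.TorusGhostPairStencils (gh₂)
open Summit.QuantumFields.BalabanUV.Beta.D1BFx.CombFPWordArrays (nFcol)
open Summit.QuantumFields.BalabanUV.Beta.D1BFx.WardJetsFromNoether (oslot)
open Summit.QuantumFields.BalabanUV.Beta.D1BFx.ColourLiftAdE3 (c₃)
open Summit.QuantumFields.BalabanUV.Beta.D1BFx.PeriodicArrayWrapColH (colH_weight biLoc_sliceSum_images_colH tendsto_sliceSum_images_colH)
open Summit.QuantumFields.BalabanUV.Beta.D1BFx.PackedDictionaryLetters (locStencil_mono body_mono packed_first_kkt packed_first_parity packed_second_kkt_sgn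
  packed_second_parity)
open Summit.QuantumFields.BalabanUV.Beta.D1BFx.PackedBlockGlue (response_siteOf_eq_tsum_colH)
open Summit.QuantumFields.BalabanUV.Beta.D1BFx.PackedWardLettersSecond (packed_ward₂_field)
open Summit.QuantumFields.BalabanUV.Beta.D1BFx.PackedLettersAtSites (ffHat_packed_site mfHat_packed_site ffHat_packed₂_site mfHat_packed₂_site
  packed_ward₁_lifted_field vertex2OfK_eq_sliceSum)
open Summit.QuantumFields.BalabanUV.Beta.D1BFx.PackedTowerCombine (hessKer_transfer_road_cov_packed_of_uniform)

variable (m : ℕ) {a : ℝ} {r : Fin 4 → ℕ}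

/-- [folklore] **(B3) PART 3b «A1-PACKED-TORUS — INSTANTIATION»: THE `ℤ⁴` IDENTITY OF THE COVARIANT ORGANISATION FOR THE LITERAL's RESPONSE-PACKED JETS.**
For `0 < a`, `Spr (Ga (m+1) a)`, `r ∈ box 4 (m+1)`; a first-derivative stencil family `S` and a second-derivative stencil family `S₂` of the literal with their
STRUCTURAL SOCKETS; coarse periods `p k → ∞`; on every torus the per-bond data `K₁ Q₁ x₁ K₂ Q₂ x₂` PINNED to the blocks of the periodised single-bond ∕ pair
stencil arrays and THE CONVENTION's generator jets, satisfying the literal's LIFTED table-level Ward identities [P1′]∕[P2′] (`C 2 = c₃`); the responses `rS rT`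
PINNED to the columns of `M_T⁻¹` at `(siteOf (p k) 0, μ)` ∕ `(siteOf (p k) z, ν)`; the parity-typed jets `k• q•` PINNED to the blocks of the periodised packed
tables; TB4-W's co-frame pins; the N side with its (u1)∕(u2) sockets and dictionary letters `hJN•` as in (B6′).  THEN, with `G₀ := coDressKBmAt (toSite r) (m+1) (KInvStep (m+1) 0)`,
`hessKer G₀ (vertexOfK G₀ (m+1) S) (vertex2OfK G₀ (m+1) S₂) μ ν z + hessKer (Cgh (m+1) a) ℒ ℒ₂ μ ν z = hessKer (NlegRoad m a) 𝒱N∞ 𝒲N∞ μ ν z + 2·hessKer idK1 𝒳 𝒳₂ μ ν z`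
— the M side through the CHAIN-RULE VERTEX and the BI-VERTEX of the literal's stencils BY NAME (PART 3a §4), the tower families `ℒ ℒ₂ 𝒳 𝒳₂` those of (B6′) at the weights
`colH G₀ (m+1)` — every M-side letter of (B6′) (`hVM hVM′ hWM hlimVM hlimVM′ hlimWM hwS hwT hrS hrT hW• hk• a• b• hJM•`) DISCHARGED by PART 1∕1c∕2b∕3a, gan24-leaf-05's
«WRAP» lemmas and `vertexFamily_vertexOfK`. -/
theorem hessKer_transfer_road_cov_packed_literal (ha : 0 < a) (hGa : Spr (GluonLeg.Ga (m + 1) a)) (hr : r ∈ box (3 + 1) (m + 1))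
    -- the literal's first-derivative stencil family and its STRUCTURAL SOCKETS
    (S : Fin 4 → (Fin 4 → ℤ) → MKer 4 (Fib 3)) {Cs δS : ℝ} (hS : LocStencil S Cs δS) (hCs : 0 ≤ Cs) (hδS : 0 < δS)
    (hScov : ∀ κ' u v, S κ' (u + v) = shiftK (-v) (S κ' u))
    (hSmm : ∀ κ' u x y (c b : Fin 4), S κ' u x y (Sum.inr c) (Sum.inr b) = 0)
    (hSfm : ∀ κ' u x y (c b : Fin 4), S κ' u x y (Sum.inl c) (Sum.inr b) = S κ' u y x (Sum.inr b) (Sum.inl c))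
    (hSff : ∀ κ' u x y (c b : Fin 4), S κ' u x y (Sum.inl c) (Sum.inl b) = -S κ' u y x (Sum.inl b) (Sum.inl c))
    -- the literal's second-derivative stencil family and its STRUCTURAL SOCKETS
    (S₂ : Fin 4 → (Fin 4 → ℤ) → Fin 4 → (Fin 4 → ℤ) → MKer 4 (Fib 3)) {Ck δ₂ : ℝ}
    (hS₂ : ∀ κ u κ' u', BiLoc (S₂ κ u κ' u') u u (Ck * Real.exp (-δ₂ * l1 (u' - u))) δ₂) (hCk : 0 ≤ Ck) (hδ₂ : 0 < δ₂)
    (hS₂cov : ∀ κ' κ'' u u' v, S₂ κ' (u + v) κ'' (u' + v) = shiftK (-v) (S₂ κ' u κ'' u'))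
    (hS₂mm : ∀ κ u κ' u' x y (c b : Fin 4), S₂ κ u κ' u' x y (Sum.inr c) (Sum.inr b) = 0)
    (hS₂fm : ∀ κ u κ' u' x y (c b : Fin 4), S₂ κ u κ' u' x y (Sum.inl c) (Sum.inr b) = -S₂ κ u κ' u' y x (Sum.inr b) (Sum.inl c))
    (hS₂ff : ∀ κ u κ' u' x y (c b : Fin 4), S₂ κ u κ' u' x y (Sum.inl c) (Sum.inl b) = S₂ κ u κ' u' y x (Sum.inl b) (Sum.inl c))
    (μ ν : Fin 4) (z : Fin 4 → ℤ)
    -- the N side VERBATIM as in (B6′)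
    (𝒱N : ℕ → Fin 4 → (Fin 4 → ℤ) → MKer 4 (Fib 3)) (𝒲N : ℕ → Fin 4 → (Fin 4 → ℤ) → Fin 4 → (Fin 4 → ℤ) → MKer 4 (Fib 3))
    (𝒱Ninf : Fin 4 → (Fin 4 → ℤ) → MKer 4 (Fib 3)) (𝒲Ninf : Fin 4 → (Fin 4 → ℤ) → Fin 4 → (Fin 4 → ℤ) → MKer 4 (Fib 3))
    {PN PN' QN QN' : Fin 4 → ℤ} {CvN CvN' CN δN : ℝ}
    (hVN : ∀ k, BiLoc (𝒱N k μ 0) PN PN' CvN δN) (hVN' : ∀ k, BiLoc (𝒱N k ν z) QN' QN CvN' δN)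
    (hWN : ∀ k, BiLoc (𝒲N k μ 0 ν z) PN QN CN δN) (hδN : 0 < δN)
    (hlimVN : ∀ x y c b, Tendsto (fun k => 𝒱N k μ 0 x y c b) atTop (𝓝 (𝒱Ninf μ 0 x y c b)))
    (hlimVN' : ∀ x y c b, Tendsto (fun k => 𝒱N k ν z x y c b) atTop (𝓝 (𝒱Ninf ν z x y c b)))
    (hlimWN : ∀ x y c b, Tendsto (fun k => 𝒲N k μ 0 ν z x y c b) atTop (𝓝 (𝒲Ninf μ 0 ν z x y c b)))
    {p : ℕ → ℕ} [∀ k, NeZero (p k)] (hp : Tendsto p atTop atTop)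
    -- the responses PINNED to the columns of the torus comb-gauged KKT inverse
    (rS rT : ∀ k, I 3 (m + 1) (p k) → ℝ)
    (hrS : ∀ k i, rS k i = (kkt (Khat (d := 3) (m + 1) (p k)) (Matrix.fromRows (Qhat (d := 3) (m + 1) (p k)) (tauT (toSite r) (m + 1) (p k))))⁻¹
      (Sum.inl i) (Sum.inr (Sum.inl (siteOf 4 (p k) 0, μ))))
    (hrT : ∀ k i, rT k i = (kkt (Khat (d := 3) (m + 1) (p k)) (Matrix.fromRows (Qhat (d := 3) (m + 1) (p k)) (tauT (toSite r) (m + 1) (p k))))⁻¹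
      (Sum.inl i) (Sum.inr (Sum.inl (siteOf 4 (p k) z, ν))))
    -- co-frame data pinned to TB4-W's jets PACKED by the responses («COFRAME-PACK»), VERBATIM as in (B6′)
    (T₀ Tₛ Tₜ Tₛₜ : ∀ k, Matrix (CombRows (toSite r) (m + 1) (p k)) (I 3 (m + 1) (p k)) ℝ)
    (A₀ Aₛ Aₜ Aₛₜ : ∀ k, Matrix (CombRows (toSite r) (m + 1) (p k)) (CombRows (toSite r) (m + 1) (p k)) ℝ)
    (hT₀ : ∀ k, T₀ k = Tjet₀ ((m + 1) * p k) (Nhat r (m + 1) (p k)) (e₁ (m + 1) (p k)))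
    (hTₛ : ∀ k, Tₛ k = ∑ i : I 3 (m + 1) (p k), rS k i • Tjet₁ ((m + 1) * p k) (e₁ (m + 1) (p k) i) (Nhat r (m + 1) (p k)) (e₁ (m + 1) (p k)))
    (hTₜ : ∀ k, Tₜ k = ∑ i : I 3 (m + 1) (p k), rT k i • Tjet₁ ((m + 1) * p k) (e₁ (m + 1) (p k) i) (Nhat r (m + 1) (p k)) (e₁ (m + 1) (p k)))
    (hTₛₜ : ∀ k, Tₛₜ k = ∑ i : I 3 (m + 1) (p k), ∑ j : I 3 (m + 1) (p k), (rS k i * rT k j) •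
      Tjet₁₁ ((m + 1) * p k) (e₁ (m + 1) (p k) i) (e₁ (m + 1) (p k) j) (Nhat r (m + 1) (p k)) (e₁ (m + 1) (p k)))
    (hA₀ : ∀ k, A₀ k = Ajet₀ ((m + 1) * p k) (Nhat r (m + 1) (p k)))
    (hAₛ : ∀ k, Aₛ k = ∑ i : I 3 (m + 1) (p k), rS k i • Ajet₁ ((m + 1) * p k) (e₁ (m + 1) (p k) i) (Nhat r (m + 1) (p k)))
    (hAₜ : ∀ k, Aₜ k = ∑ i : I 3 (m + 1) (p k), rT k i • Ajet₁ ((m + 1) * p k) (e₁ (m + 1) (p k) i) (Nhat r (m + 1) (p k)))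
    (hAₛₜ : ∀ k, Aₛₜ k = ∑ i : I 3 (m + 1) (p k), ∑ j : I 3 (m + 1) (p k), (rS k i * rT k j) •
      Ajet₁₁ ((m + 1) * p k) (e₁ (m + 1) (p k) i) (e₁ (m + 1) (p k) j) (Nhat r (m + 1) (p k)))
    -- the literal's per-bond torus data PINNED to the periodised single-bond ∕ pair stencil arrays and THE CONVENTION's generator jets
    (K₁ : ∀ k, I 3 (m + 1) (p k) ⊕ J 3 (p k) → Matrix (I 3 (m + 1) (p k)) (I 3 (m + 1) (p k)) ℝ)
    (Q₁ : ∀ k, I 3 (m + 1) (p k) ⊕ J 3 (p k) → Matrix (J 3 (p k)) (I 3 (m + 1) (p k)) ℝ)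
    (x₁ : ∀ k, I 3 (m + 1) (p k) ⊕ J 3 (p k) → Matrix (I 3 (m + 1) (p k)) (CombRows (toSite r) (m + 1) (p k)) ℝ)
    (K₂ : ∀ k, I 3 (m + 1) (p k) ⊕ J 3 (p k) → I 3 (m + 1) (p k) ⊕ J 3 (p k) → Matrix (I 3 (m + 1) (p k)) (I 3 (m + 1) (p k)) ℝ)
    (Q₂ : ∀ k, I 3 (m + 1) (p k) ⊕ J 3 (p k) → I 3 (m + 1) (p k) ⊕ J 3 (p k) → Matrix (J 3 (p k)) (I 3 (m + 1) (p k)) ℝ)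
    (x₂ : ∀ k, I 3 (m + 1) (p k) ⊕ J 3 (p k) → I 3 (m + 1) (p k) ⊕ J 3 (p k) → Matrix (I 3 (m + 1) (p k)) (CombRows (toSite r) (m + 1) (p k)) ℝ)
    (hK₁ : ∀ k i, K₁ k (Sum.inl i) = Matrix.of (periodiseF (p k) (fTL (sortK (m + 1) (arr ((m + 1) * p k)
      (S i.2.2 (windowMap 4 ((m + 1) * p k) (torusBlockEquiv (m + 1) (p k) (i.1, i.2.1)))))))))
    (hQ₁ : ∀ k i, Q₁ k (Sum.inl i) = Matrix.of (periodiseF (p k) (fBL (sortK (m + 1) (arr ((m + 1) * p k)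
      (S i.2.2 (windowMap 4 ((m + 1) * p k) (torusBlockEquiv (m + 1) (p k) (i.1, i.2.1)))))))))
    (hx₁ : ∀ k i, x₁ k (Sum.inl i) = (Djet ((m + 1) * p k) (e₁ (m + 1) (p k) i)).submatrix (e₁ (m + 1) (p k)) id * Nhat r (m + 1) (p k))
    (hK₂ : ∀ k i j, K₂ k (Sum.inl i) (Sum.inl j) = Matrix.of (periodiseF (p k) (fTL (sortK (m + 1) (fun x y c b => ∑' t : Fin 4 → ℤ,
      arr ((m + 1) * p k) (S₂ i.2.2 (windowMap 4 ((m + 1) * p k) (torusBlockEquiv (m + 1) (p k) (i.1, i.2.1))) j.2.2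
        (imageShift ((m + 1) * p k) (windowMap 4 ((m + 1) * p k) (torusBlockEquiv (m + 1) (p k) (j.1, j.2.1))) t)) x y c b)))))
    (hQ₂ : ∀ k i j, Q₂ k (Sum.inl i) (Sum.inl j) = Matrix.of (periodiseF (p k) (fBL (sortK (m + 1) (fun x y c b => ∑' t : Fin 4 → ℤ,
      arr ((m + 1) * p k) (S₂ i.2.2 (windowMap 4 ((m + 1) * p k) (torusBlockEquiv (m + 1) (p k) (i.1, i.2.1))) j.2.2
        (imageShift ((m + 1) * p k) (windowMap 4 ((m + 1) * p k) (torusBlockEquiv (m + 1) (p k) (j.1, j.2.1))) t)) x y c b)))))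
    (hx₂ : ∀ k i j, x₂ k (Sum.inl i) (Sum.inl j) = if i = j then x₁ k (Sum.inl i) else 0)
    (hK₁0 : ∀ k j, K₁ k (Sum.inr j) = 0) (hQ₁0 : ∀ k j, Q₁ k (Sum.inr j) = 0) (hx₁0 : ∀ k j, x₁ k (Sum.inr j) = 0)
    (hK₂0 : ∀ k j q, K₂ k (Sum.inr j) q = 0) (hK₂0' : ∀ k q j, K₂ k q (Sum.inr j) = 0)
    (hQ₂0 : ∀ k j q, Q₂ k (Sum.inr j) q = 0) (hQ₂0' : ∀ k q j, Q₂ k q (Sum.inr j) = 0)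
    (hx₂0 : ∀ k j q, x₂ k (Sum.inr j) q = 0) (hx₂0' : ∀ k q j, x₂ k q (Sum.inr j) = 0)
    -- the literal's LIFTED table-level Ward identities [P1′]∕[P2′] in the `ad e₃` model (ρ-g16-1′), per torus
    (C : Fin 3 → Matrix (Fin 3) (Fin 3) ℝ) (hC : C 2 = c₃)
    (hP1 : ∀ k, ∀ q : Fin 3 × (I 3 (m + 1) (p k) ⊕ J 3 (p k)),
      (C q.1 ⊗ₖ kkt (K₁ k q.2) (Q₁ k q.2))
          * ((1 : Matrix (Fin 3) (Fin 3) ℝ) ⊗ₖ Matrix.fromRows (What0 r (m + 1) (p k)) (0 : Matrix (J 3 (p k)) (CombRows (toSite r) (m + 1) (p k)) ℝ))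
      + ((1 : Matrix (Fin 3) (Fin 3) ℝ) ⊗ₖ kkt (Khat (d := 3) (m + 1) (p k)) (Qhat (d := 3) (m + 1) (p k)))
          * (C q.1 ⊗ₖ Matrix.fromRows (x₁ k q.2) (0 : Matrix (J 3 (p k)) (CombRows (toSite r) (m + 1) (p k)) ℝ))
      + oslot (fun q' : Fin 3 × (I 3 (m + 1) (p k) ⊕ J 3 (p k)) =>
            C q'.1 ⊗ₖ Matrix.fromRows (x₁ k q'.2) (0 : Matrix (J 3 (p k)) (CombRows (toSite r) (m + 1) (p k)) ℝ))
          (fun i => ((1 : Matrix (Fin 3) (Fin 3) ℝ) ⊗ₖ kkt (Khat (d := 3) (m + 1) (p k)) (Qhat (d := 3) (m + 1) (p k))) i q) = 0)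
    (hP2 : ∀ k, ∀ q q'' : Fin 3 × (I 3 (m + 1) (p k) ⊕ J 3 (p k)),
      ((C q.1 * C q''.1) ⊗ₖ kkt (K₂ k q.2 q''.2) (Q₂ k q.2 q''.2))
          * ((1 : Matrix (Fin 3) (Fin 3) ℝ) ⊗ₖ Matrix.fromRows (What0 r (m + 1) (p k)) (0 : Matrix (J 3 (p k)) (CombRows (toSite r) (m + 1) (p k)) ℝ))
      + (C q.1 ⊗ₖ kkt (K₁ k q.2) (Q₁ k q.2))
          * (C q''.1 ⊗ₖ Matrix.fromRows (x₁ k q''.2) (0 : Matrix (J 3 (p k)) (CombRows (toSite r) (m + 1) (p k)) ℝ))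
      + (C q''.1 ⊗ₖ kkt (K₁ k q''.2) (Q₁ k q''.2))
          * (C q.1 ⊗ₖ Matrix.fromRows (x₁ k q.2) (0 : Matrix (J 3 (p k)) (CombRows (toSite r) (m + 1) (p k)) ℝ))
      + ((1 : Matrix (Fin 3) (Fin 3) ℝ) ⊗ₖ kkt (Khat (d := 3) (m + 1) (p k)) (Qhat (d := 3) (m + 1) (p k)))
          * ((C q.1 * C q''.1) ⊗ₖ Matrix.fromRows (x₂ k q.2 q''.2) (0 : Matrix (J 3 (p k)) (CombRows (toSite r) (m + 1) (p k)) ℝ))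
      + oslot (fun q' : Fin 3 × (I 3 (m + 1) (p k) ⊕ J 3 (p k)) =>
            C q'.1 ⊗ₖ Matrix.fromRows (x₁ k q'.2) (0 : Matrix (J 3 (p k)) (CombRows (toSite r) (m + 1) (p k)) ℝ))
          (fun i => (C q''.1 ⊗ₖ kkt (K₁ k q''.2) (Q₁ k q''.2)) i q)
      + oslot (fun q' : Fin 3 × (I 3 (m + 1) (p k) ⊕ J 3 (p k)) =>
            (C q''.1 * C q'.1) ⊗ₖ Matrix.fromRows (x₂ k q''.2 q'.2) (0 : Matrix (J 3 (p k)) (CombRows (toSite r) (m + 1) (p k)) ℝ))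
          (fun i => ((1 : Matrix (Fin 3) (Fin 3) ℝ) ⊗ₖ kkt (Khat (d := 3) (m + 1) (p k)) (Qhat (d := 3) (m + 1) (p k))) i q)
      + oslot (fun p' : Fin 3 × (I 3 (m + 1) (p k) ⊕ J 3 (p k)) =>
            (C q.1 * C p'.1) ⊗ₖ Matrix.fromRows (x₂ k q.2 p'.2) (0 : Matrix (J 3 (p k)) (CombRows (toSite r) (m + 1) (p k)) ℝ))
          (fun i => ((1 : Matrix (Fin 3) (Fin 3) ℝ) ⊗ₖ kkt (Khat (d := 3) (m + 1) (p k)) (Qhat (d := 3) (m + 1) (p k))) i q'') = 0)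
    -- the parity-typed form ∕ constraint jets PINNED to the blocks of the periodised packed tables
    (kₛ kₜ kₛₜ : ∀ k, Matrix (I 3 (m + 1) (p k)) (I 3 (m + 1) (p k)) ℝ) (qₛ qₜ qₛₜ : ∀ k, Matrix (J 3 (p k)) (I 3 (m + 1) (p k)) ℝ)
    (hkₛ : ∀ k, kₛ k = Matrix.of (periodiseF (p k) (fTL (sortK (m + 1) (arr ((m + 1) * p k)
      (vertexOfK (coDressKBmAt (toSite r) (m + 1) (KInvStep (d := 3) (m + 1) 0)) (m + 1) S μ 0))))))
    (hqₛ : ∀ k, qₛ k = Matrix.of (periodiseF (p k) (fBL (sortK (m + 1) (arr ((m + 1) * p k)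
      (vertexOfK (coDressKBmAt (toSite r) (m + 1) (KInvStep (d := 3) (m + 1) 0)) (m + 1) S μ 0))))))
    (hkₜ : ∀ k, kₜ k = Matrix.of (periodiseF (p k) (fTL (sortK (m + 1) (arr ((m + 1) * p k)
      (vertexOfK (coDressKBmAt (toSite r) (m + 1) (KInvStep (d := 3) (m + 1) 0)) (m + 1) S ν z))))))
    (hqₜ : ∀ k, qₜ k = Matrix.of (periodiseF (p k) (fBL (sortK (m + 1) (arr ((m + 1) * p k)
      (vertexOfK (coDressKBmAt (toSite r) (m + 1) (KInvStep (d := 3) (m + 1) 0)) (m + 1) S ν z))))))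
    (hkₛₜ : ∀ k, kₛₜ k = Matrix.of (periodiseF (p k) (fTL (sortK (m + 1) (arr ((m + 1) * p k) (fun x y c b => ∑ κ' : Fin 4, ∑ κ'' : Fin 4,
      wsum (colH (coDressKBmAt (toSite r) (m + 1) (KInvStep (d := 3) (m + 1) 0)) (m + 1) μ 0 κ')
        (fun u => wsum (fun u'' => ∑' t : Fin 4 → ℤ,
          colH (coDressKBmAt (toSite r) (m + 1) (KInvStep (d := 3) (m + 1) 0)) (m + 1) ν z κ'' (imageShift ((m + 1) * p k) u'' t)) (S₂ κ' u κ''))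
        x y c b))))))
    (hqₛₜ : ∀ k, qₛₜ k = Matrix.of (periodiseF (p k) (fBL (sortK (m + 1) (arr ((m + 1) * p k) (fun x y c b => ∑ κ' : Fin 4, ∑ κ'' : Fin 4,
      wsum (colH (coDressKBmAt (toSite r) (m + 1) (KInvStep (d := 3) (m + 1) 0)) (m + 1) μ 0 κ')
        (fun u => wsum (fun u'' => ∑' t : Fin 4 → ℤ,
          colH (coDressKBmAt (toSite r) (m + 1) (KInvStep (d := 3) (m + 1) 0)) (m + 1) ν z κ'' (imageShift ((m + 1) * p k) u'' t)) (S₂ κ' u κ''))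
        x y c b))))))
    -- the (A2-N) dictionary AT THE k-TH TABLES, VERBATIM as in (B6′)
    (hJN : ∀ k, tj₂ (kₛ k + tgram₁ (T₀ k) (Tₛ k) (A₀ k) (Aₛ k)) (qₛ k) = blocksHat (p k) (sortK (m + 1) (arr ((m + 1) * p k) (𝒱N k μ 0))))
    (hJN' : ∀ k, tj₂ (kₜ k + tgram₁ (T₀ k) (Tₜ k) (A₀ k) (Aₜ k)) (qₜ k) = blocksHat (p k) (sortK (m + 1) (arr ((m + 1) * p k) (𝒱N k ν z))))
    (hJN'' : ∀ k, kkt (kₛₜ k + tgramMix (T₀ k) (Tₛ k) (Tₜ k) (Tₛₜ k) (A₀ k) (Aₛ k) (Aₜ k) (Aₛₜ k)) (qₛₜ k)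
        = blocksHat (p k) (sortK (m + 1) (arr ((m + 1) * p k) (𝒲N k μ 0 ν z)))) :
    hessKer (coDressKBmAt (toSite r) (m + 1) (KInvStep (d := 3) (m + 1) 0))
          (vertexOfK (coDressKBmAt (toSite r) (m + 1) (KInvStep (d := 3) (m + 1) 0)) (m + 1) S)
          (vertex2OfK (coDressKBmAt (toSite r) (m + 1) (KInvStep (d := 3) (m + 1) 0)) (m + 1) S₂) μ ν z
        + hessKer (Cgh (m + 1) a)
          (fun κ' v => fun x y c b => ∑ κ : Fin 4, wsum (colH (coDressKBmAt (toSite r) (m + 1) (KInvStep (d := 3) (m + 1) 0)) (m + 1) κ' v κ) (Lgh κ) x y c b)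
          (fun κ' v l v' =>
            comp (fun x y c b => ∑ κ : Fin 4, wsum (colH (coDressKBmAt (toSite r) (m + 1) (KInvStep (d := 3) (m + 1) 0)) (m + 1) κ' v κ)
                (fun u => fun x y c b => colH (coDressKBmAt (toSite r) (m + 1) (KInvStep (d := 3) (m + 1) 0)) (m + 1) l v' κ u * gh₂ κ u x y c b) x y c b) lapU
              + comp (fun x y c b => ∑ κ : Fin 4, wsum (colH (coDressKBmAt (toSite r) (m + 1) (KInvStep (d := 3) (m + 1) 0)) (m + 1) κ' v κ) (ghCur κ) x y c b)
                  (fun x y c b => ∑ κ : Fin 4, wsum (colH (coDressKBmAt (toSite r) (m + 1) (KInvStep (d := 3) (m + 1) 0)) (m + 1) l v' κ) (ghCur κ) x y c b)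
              + comp (fun x y c b => ∑ κ : Fin 4, wsum (colH (coDressKBmAt (toSite r) (m + 1) (KInvStep (d := 3) (m + 1) 0)) (m + 1) l v' κ) (ghCur κ) x y c b)
                  (fun x y c b => ∑ κ : Fin 4, wsum (colH (coDressKBmAt (toSite r) (m + 1) (KInvStep (d := 3) (m + 1) 0)) (m + 1) κ' v κ) (ghCur κ) x y c b)
              + comp lapU (fun x y c b => ∑ κ : Fin 4, wsum (colH (coDressKBmAt (toSite r) (m + 1) (KInvStep (d := 3) (m + 1) 0)) (m + 1) κ' v κ)
                (fun u => fun x y c b => colH (coDressKBmAt (toSite r) (m + 1) (KInvStep (d := 3) (m + 1) 0)) (m + 1) l v' κ u * gh₂ κ u x y c b) x y c b))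
          μ ν z
      = hessKer (NlegRoad m a) 𝒱Ninf 𝒲Ninf μ ν z
        + 2 * hessKer idK1
          (fun κ' v => fun x y c b => ∑ κ : Fin 4, wsum (colH (coDressKBmAt (toSite r) (m + 1) (KInvStep (d := 3) (m + 1) 0)) (m + 1) κ' v κ) (nFcol r (m + 1) κ) x y c b)
          (fun κ' v l v' => fun x y c b => ∑ κ : Fin 4, wsum (colH (coDressKBmAt (toSite r) (m + 1) (KInvStep (d := 3) (m + 1) 0)) (m + 1) κ' v κ)
            (fun u => fun x y c b => colH (coDressKBmAt (toSite r) (m + 1) (KInvStep (d := 3) (m + 1) 0)) (m + 1) l v' κ u * nFcol r (m + 1) κ u x y c b) x y c b)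
          μ ν z := by
  -- the road's decaying block-covariant resolvent `G₀` and a common rate for the three localisations
  obtain ⟨δG, CG, hδG, hCG, hG⟩ := decays_coDressKBmAt_KInvStep (d := 3) hr 0
  have hδc : 0 < min (min δS δ₂) δG := lt_min (lt_min hδS hδ₂) hδG
  have hcS : min (min δS δ₂) δG ≤ δS := (min_le_left _ _).trans (min_le_left _ _)
  have hc₂ : min (min δS δ₂) δG ≤ δ₂ := (min_le_left _ _).trans (min_le_right _ _)
  have hcG : min (min δS δ₂) δG ≤ δG := min_le_right _ _
  have hS' := locStencil_mono hS hCs hcS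
  have hS₂' := body_mono hS₂ hCk hc₂
  -- the bi-vertex BY NAME is the slice-summed double superposition (PART 3a §4)
  have e2 : vertex2OfK (coDressKBmAt (toSite r) (m + 1) (KInvStep (d := 3) (m + 1) 0)) (m + 1) S₂
      = fun κ₁ y₁ κ₂ y₂ => fun x y c b => ∑ κ' : Fin 4, ∑ κ'' : Fin 4,
          wsum (colH (coDressKBmAt (toSite r) (m + 1) (KInvStep (d := 3) (m + 1) 0)) (m + 1) κ₁ y₁ κ')
            (fun u => wsum (colH (coDressKBmAt (toSite r) (m + 1) (KInvStep (d := 3) (m + 1) 0)) (m + 1) κ₂ y₂ κ'') (S₂ κ' u κ'')) x y c b :=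
    funext fun κ₁ => funext fun y₁ => funext fun κ₂ => funext fun y₂ => vertex2OfK_eq_sliceSum (N := m + 1) hG hCG hS₂' hCk hδc hcG κ₁ y₁ κ₂ y₂
  rw [e2]
  -- (u1) for the M side: the packed first jet is a vertex family; the p-dependent second table is bi-localised at the first bond, re-centred
  have hV := vertexFamily_vertexOfK (N := m + 1) hG hCG hS' hδc hcG
  have hWM : ∀ k, BiLoc (fun x y c b => ∑ κ' : Fin 4, ∑ κ'' : Fin 4,
      wsum (colH (coDressKBmAt (toSite r) (m + 1) (KInvStep (d := 3) (m + 1) 0)) (m + 1) μ 0 κ')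
        (fun u => wsum (fun u'' => ∑' t : Fin 4 → ℤ,
          colH (coDressKBmAt (toSite r) (m + 1) (KInvStep (d := 3) (m + 1) 0)) (m + 1) ν z κ'' (imageShift ((m + 1) * p k) u'' t)) (S₂ κ' u κ''))
        x y c b) (((m + 1 : ℕ) : ℤ) • (0 : Fin 4 → ℤ)) (((m + 1 : ℕ) : ℤ) • z)
      ((((3 + 1 : ℕ) : ℝ)) ^ 2 * (CG * (CG * Ck * Zl (3 + 1) (min (min δS δ₂) δG / 2) * Zl (3 + 1) (min (min δS δ₂) δG / 2))
          * Zl (3 + 1) (min (min δS δ₂) δG / 2))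
        * Real.exp (min (min δS δ₂) δG / 2 * (l1 ((((m + 1 : ℕ) : ℤ) • (0 : Fin 4 → ℤ)) - ((m + 1 : ℕ) : ℤ) • (0 : Fin 4 → ℤ))
          + l1 ((((m + 1 : ℕ) : ℤ) • (0 : Fin 4 → ℤ)) - ((m + 1 : ℕ) : ℤ) • z))))
      (min (min δS δ₂) δG / 2) := fun k =>
    KernelWard.biLoc_recentre (biLoc_sliceSum_images_colH (n := m + 1) hG hCG hS₂' hδc hcG ((m + 1) * p k) μ ν 0 z) (half_pos hδc).le _ _
  -- (u2) for the M side: «WRAP-LIMIT» along `(m+1)·p k → ∞`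
  have hs : Tendsto (fun k => (m + 1) * p k) atTop atTop := tendsto_atTop_mono (fun k => Nat.le_mul_of_pos_left (p k) (Nat.succ_pos m)) hp
  have hlimWM : ∀ x y c b, Tendsto (fun k => (∑ κ' : Fin 4, ∑ κ'' : Fin 4,
      wsum (colH (coDressKBmAt (toSite r) (m + 1) (KInvStep (d := 3) (m + 1) 0)) (m + 1) μ 0 κ')
        (fun u => wsum (fun u'' => ∑' t : Fin 4 → ℤ,
          colH (coDressKBmAt (toSite r) (m + 1) (KInvStep (d := 3) (m + 1) 0)) (m + 1) ν z κ'' (imageShift ((m + 1) * p k) u'' t)) (S₂ κ' u κ''))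
        x y c b)) atTop
      (𝓝 (∑ κ' : Fin 4, ∑ κ'' : Fin 4, wsum (colH (coDressKBmAt (toSite r) (m + 1) (KInvStep (d := 3) (m + 1) 0)) (m + 1) μ 0 κ')
        (fun u => wsum (colH (coDressKBmAt (toSite r) (m + 1) (KInvStep (d := 3) (m + 1) 0)) (m + 1) ν z κ'') (S₂ κ' u κ'')) x y c b)) :=
    fun x y c b => (tendsto_sliceSum_images_colH (n := m + 1) hG hCG hS₂' hδc hcG μ ν 0 z x y c b).comp hs
  -- the packing weights decay from the coarse bonds' centres at the rate `min δG ½`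
  have hδw : 0 < min δG (1 / 2) := lt_min hδG one_half_pos
  have hwS : ∀ κ u, |colH (coDressKBmAt (toSite r) (m + 1) (KInvStep (d := 3) (m + 1) 0)) (m + 1) μ 0 κ u|
      ≤ CG * Real.exp (-(min δG (1 / 2)) * l1 (u - ((m + 1 : ℕ) : ℤ) • (0 : Fin 4 → ℤ))) := fun κ u => colH_weight hG hCG (min_le_left _ _) μ 0 κ u
  have hwT : ∀ κ u, |colH (coDressKBmAt (toSite r) (m + 1) (KInvStep (d := 3) (m + 1) 0)) (m + 1) ν z κ u|
      ≤ CG * Real.exp (-(min δG (1 / 2)) * l1 (u - ((m + 1 : ℕ) : ℤ) • z)) := fun κ u => colH_weight hG hCG (min_le_left _ _) ν z κ u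
  -- the response letters (PART 1c's coarse-representative invariance)
  have hrS' : ∀ k i, rS k i = ∑' t : Fin 4 → ℤ, colH (coDressKBmAt (toSite r) (m + 1) (KInvStep (d := 3) (m + 1) 0)) (m + 1) μ 0 i.2.2
      (imageShift ((m + 1) * p k) (windowMap 4 ((m + 1) * p k) (torusBlockEquiv (m + 1) (p k) (i.1, i.2.1))) t) := fun k i => by
    rw [hrS k i]; exact response_siteOf_eq_tsum_colH hr (p k) 0 μ i
  have hrT' : ∀ k i, rT k i = ∑' t : Fin 4 → ℤ, colH (coDressKBmAt (toSite r) (m + 1) (KInvStep (d := 3) (m + 1) 0)) (m + 1) ν z i.2.2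
      (imageShift ((m + 1) * p k) (windowMap 4 ((m + 1) * p k) (torusBlockEquiv (m + 1) (p k) (i.1, i.2.1))) t) := fun k i => by
    rw [hrT k i]; exact response_siteOf_eq_tsum_colH hr (p k) z ν i
  -- joint period covariance of the pair stencils from joint translation covariance
  have hS₂cov' : ∀ k κ' κ'' u u' t, S₂ κ' (imageShift ((m + 1) * p k) u t) κ'' (imageShift ((m + 1) * p k) u' t)
      = shiftK (-((((m + 1) * p k : ℕ) : ℤ) • t)) (S₂ κ' u κ'' u') := fun k κ' κ'' u u' t => by
    have e : ∀ w : Fin 4 → ℤ, imageShift ((m + 1) * p k) w t = w + (((m + 1) * p k : ℕ) : ℤ) • t := fun w => by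
      funext i; simp only [imageShift, Pi.add_apply, Pi.smul_apply, smul_eq_mul]
    rw [e, e]; exact hS₂cov κ' κ'' u u' _
  -- the parity-typed jets ARE the response-packed sums of the per-bond data (PART 3a + pins)
  have ekₛ : ∀ k, kₛ k = ∑ i, (kkt (Khat (d := 3) (m + 1) (p k)) (Matrix.fromRows (Qhat (d := 3) (m + 1) (p k)) (tauT (toSite r) (m + 1) (p k))))⁻¹
      (Sum.inl i) (Sum.inr (Sum.inl (siteOf 4 (p k) 0, μ))) • K₁ k (Sum.inl i) := fun k => by
    rw [hkₛ k, ffHat_packed_site hr (p k) hS hCs hδS hScov 0 μ]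
    exact Finset.sum_congr rfl fun i _ => by rw [hK₁ k i]
  have eqₛ : ∀ k, qₛ k = ∑ i, (kkt (Khat (d := 3) (m + 1) (p k)) (Matrix.fromRows (Qhat (d := 3) (m + 1) (p k)) (tauT (toSite r) (m + 1) (p k))))⁻¹
      (Sum.inl i) (Sum.inr (Sum.inl (siteOf 4 (p k) 0, μ))) • Q₁ k (Sum.inl i) := fun k => by
    rw [hqₛ k, mfHat_packed_site hr (p k) hS hCs hδS hScov 0 μ]
    exact Finset.sum_congr rfl fun i _ => by rw [hQ₁ k i]
  have ekₜ : ∀ k, kₜ k = ∑ i, (kkt (Khat (d := 3) (m + 1) (p k)) (Matrix.fromRows (Qhat (d := 3) (m + 1) (p k)) (tauT (toSite r) (m + 1) (p k))))⁻¹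
      (Sum.inl i) (Sum.inr (Sum.inl (siteOf 4 (p k) z, ν))) • K₁ k (Sum.inl i) := fun k => by
    rw [hkₜ k, ffHat_packed_site hr (p k) hS hCs hδS hScov z ν]
    exact Finset.sum_congr rfl fun i _ => by rw [hK₁ k i]
  have eqₜ : ∀ k, qₜ k = ∑ i, (kkt (Khat (d := 3) (m + 1) (p k)) (Matrix.fromRows (Qhat (d := 3) (m + 1) (p k)) (tauT (toSite r) (m + 1) (p k))))⁻¹
      (Sum.inl i) (Sum.inr (Sum.inl (siteOf 4 (p k) z, ν))) • Q₁ k (Sum.inl i) := fun k => by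
    rw [hqₜ k, mfHat_packed_site hr (p k) hS hCs hδS hScov z ν]
    exact Finset.sum_congr rfl fun i _ => by rw [hQ₁ k i]
  have ekₛₜ : ∀ k, kₛₜ k = ∑ i, ∑ j, ((kkt (Khat (d := 3) (m + 1) (p k)) (Matrix.fromRows (Qhat (d := 3) (m + 1) (p k)) (tauT (toSite r) (m + 1) (p k))))⁻¹
        (Sum.inl i) (Sum.inr (Sum.inl (siteOf 4 (p k) 0, μ)))
      * (kkt (Khat (d := 3) (m + 1) (p k)) (Matrix.fromRows (Qhat (d := 3) (m + 1) (p k)) (tauT (toSite r) (m + 1) (p k))))⁻¹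
        (Sum.inl j) (Sum.inr (Sum.inl (siteOf 4 (p k) z, ν)))) • K₂ k (Sum.inl i) (Sum.inl j) := fun k => by
    rw [hkₛₜ k, ffHat_packed₂_site hr (p k) hS₂ hCk hδ₂ (hS₂cov' k) 0 z μ ν]
    exact Finset.sum_congr rfl fun i _ => Finset.sum_congr rfl fun j _ => by rw [hK₂ k i j]
  have eqₛₜ : ∀ k, qₛₜ k = ∑ i, ∑ j, ((kkt (Khat (d := 3) (m + 1) (p k)) (Matrix.fromRows (Qhat (d := 3) (m + 1) (p k)) (tauT (toSite r) (m + 1) (p k))))⁻¹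
        (Sum.inl i) (Sum.inr (Sum.inl (siteOf 4 (p k) 0, μ)))
      * (kkt (Khat (d := 3) (m + 1) (p k)) (Matrix.fromRows (Qhat (d := 3) (m + 1) (p k)) (tauT (toSite r) (m + 1) (p k))))⁻¹
        (Sum.inl j) (Sum.inr (Sum.inl (siteOf 4 (p k) z, ν)))) • Q₂ k (Sum.inl i) (Sum.inl j) := fun k => by
    rw [hqₛₜ k, mfHat_packed₂_site hr (p k) hS₂ hCk hδ₂ (hS₂cov' k) 0 z μ ν]
    exact Finset.sum_congr rfl fun i _ => Finset.sum_congr rfl fun j _ => by rw [hQ₂ k i j]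
  -- the Ward letters of the literal at the packed jets (PART 3a from [P1′]; PART 2b from [P1′]∕[P2′])
  have hw₁S := fun k => packed_ward₁_lifted_field hr (p k) C hC (K₁ k) (Q₁ k) (x₁ k) (hP1 k) (hK₁0 k) (hQ₁0 k) (hx₁0 k)
    (Sum.inl (siteOf 4 (p k) 0, μ))
  have hw₁T := fun k => packed_ward₁_lifted_field hr (p k) C hC (K₁ k) (Q₁ k) (x₁ k) (hP1 k) (hK₁0 k) (hQ₁0 k) (hx₁0 k)
    (Sum.inl (siteOf 4 (p k) z, ν))
  have hw₂ := fun k => packed_ward₂_field hr (p k) C hC (K₁ k) (Q₁ k) (K₂ k) (Q₂ k) (x₁ k) (x₂ k) (hP1 k) (hP2 k) (hK₁0 k) (hQ₁0 k) (hx₁0 k)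
    (hK₂0 k) (hK₂0' k) (hQ₂0 k) (hQ₂0' k) (hx₂0 k) (hx₂0' k) (Sum.inl (siteOf 4 (p k) 0, μ)) (Sum.inl (siteOf 4 (p k) z, ν))
  -- (B6′) with every M-side letter supplied
  refine hessKer_transfer_road_cov_packed_of_uniform m ha hGa hr
    (fun _ => vertexOfK (coDressKBmAt (toSite r) (m + 1) (KInvStep (d := 3) (m + 1) 0)) (m + 1) S)
    (fun k κ₁ y₁ κ₂ y₂ => fun x y c b => ∑ κ' : Fin 4, ∑ κ'' : Fin 4,
      wsum (colH (coDressKBmAt (toSite r) (m + 1) (KInvStep (d := 3) (m + 1) 0)) (m + 1) κ₁ y₁ κ')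
        (fun u => wsum (fun u'' => ∑' t : Fin 4 → ℤ,
          colH (coDressKBmAt (toSite r) (m + 1) (KInvStep (d := 3) (m + 1) 0)) (m + 1) κ₂ y₂ κ'' (imageShift ((m + 1) * p k) u'' t)) (S₂ κ' u κ''))
        x y c b)
    (vertexOfK (coDressKBmAt (toSite r) (m + 1) (KInvStep (d := 3) (m + 1) 0)) (m + 1) S) _ 𝒱N 𝒲N 𝒱Ninf 𝒲Ninf μ ν z
    (fun _ => hV μ 0) (fun _ => hV ν z) hWM (half_pos hδc) (fun _ _ _ _ => tendsto_const_nhds) (fun _ _ _ _ => tendsto_const_nhds) hlimWM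
    hVN hVN' hWN hδN hlimVN hlimVN' hlimWN hp
    (colH (coDressKBmAt (toSite r) (m + 1) (KInvStep (d := 3) (m + 1) 0)) (m + 1)) hwS hwT hδw (min_le_right _ _) rS rT hrS' hrT'
    T₀ Tₛ Tₜ Tₛₜ A₀ Aₛ Aₜ Aₛₜ hT₀ hTₛ hTₜ hTₛₜ hA₀ hAₛ hAₜ hAₛₜ
    (fun k => ∑ i : I 3 (m + 1) (p k), rS k i • ((Djet ((m + 1) * p k) (e₁ (m + 1) (p k) i)).submatrix (e₁ (m + 1) (p k)) id * Nhat r (m + 1) (p k)))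
    (fun k => ∑ i : I 3 (m + 1) (p k), rT k i • ((Djet ((m + 1) * p k) (e₁ (m + 1) (p k) i)).submatrix (e₁ (m + 1) (p k)) id * Nhat r (m + 1) (p k)))
    (fun k => ∑ i : I 3 (m + 1) (p k), ∑ j : I 3 (m + 1) (p k), (rS k i * rT k j) •
      (if i = j then (Djet ((m + 1) * p k) (e₁ (m + 1) (p k) i)).submatrix (e₁ (m + 1) (p k)) id * Nhat r (m + 1) (p k) else 0))
    (fun _ => rfl) (fun _ => rfl) (fun _ => rfl)
    kₛ kₜ kₛₜ qₛ qₜ qₛₜ (fun k => ?_) (fun k => ?_) (fun k => ?_)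
    (fun k => ?_) (fun k => ?_) (fun k => ?_) (fun k => ?_) (fun k => ?_) (fun k => ?_)
    (fun k => ?_) (fun k => ?_) (fun k => ?_) hJN hJN' hJN''
  -- hkₛ hkₜ : antisymmetric first ff blocks; hkₛₜ : symmetric second ff block
  · rw [hkₛ k]; exact packed_first_parity (p k) _ μ 0 hSff
  · rw [hkₜ k]; exact packed_first_parity (p k) _ ν z hSff
  · rw [hkₛₜ k]; exact packed_second_parity (p k) hS₂ff
  -- aₛ aₜ aₛₜ
  · rw [ekₛ k]
    have h := (hw₁S k).1
    simp only [hx₁] at h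
    simpa only [hrS] using h
  · rw [ekₜ k]
    have h := (hw₁T k).1
    simp only [hx₁] at h
    simpa only [hrT] using h
  · rw [ekₛₜ k, ekₛ k, ekₜ k]
    have h := (hw₂ k).1
    simp only [hx₂, hx₁] at h
    simpa only [hrS, hrT] using h
  -- bₛ bₜ bₛₜ
  · rw [eqₛ k]
    have h := (hw₁S k).2
    simp only [hx₁] at h
    simpa only [hrS] using h
  · rw [eqₜ k]
    have h := (hw₁T k).2
    simp only [hx₁] at h
    simpa only [hrT] using h
  · rw [eqₛₜ k, eqₛ k, eqₜ k]
    have h := (hw₂ k).2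
    simp only [hx₂, hx₁] at h
    simpa only [hrS, hrT] using h
  -- hJM hJM′ hJM″
  · rw [hkₛ k, hqₛ k]; exact (packed_first_kkt (p k) _ μ 0 hSmm hSfm).symm
  · rw [hkₜ k, hqₜ k]; exact (packed_first_kkt (p k) _ ν z hSmm hSfm).symm
  · rw [hkₛₜ k, hqₛₜ k]; exact (packed_second_kkt_sgn (p k) hS₂mm hS₂fm).symm

end Summit.QuantumFields.BalabanUV.Beta.D1BFx.PackedLiteralCombine

end
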